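import Mathlib.RingTheory.ClassGroup.Basic
import Mathlib.RingTheory.DedekindDomain.Ideal.Basic
import Mathlib.LinearAlgebra.Pi
import Mathlib.Algebra.NoZeroSMulDivisors.Pi
import Mathlib.Algebra.Module.Submodule.Pointwise
import HarnessLib

/-!
# Lattices in `Rʳ` over a Dedekind domain: isomorphism classes through ideal classes

Pure commutative algebra (topic `Algebra/Module`; theorems only, no definition, no named fact).

SETTING.  `R` is a Dedekind domain and `M ⊆ Rʳ` (`Fin r → R`) an `R`-submodule which is a
LATTICE in the sense that `c • Rʳ ⊆ M` for some `c ≠ 0` (equivalently `M` has full rank).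

THE THEOREMS.
* `nonempty_linearEquiv_prod_of_smul_mem` (the splitting step, Steinitz's argument): a lattice
  `N ⊆ R × W` is isomorphic to `𝔟 × N₁` where `𝔟 = pr₁(N)` is its first coordinate ideal and
  `N₁ = N ∩ ({0} × W)`; the section of `pr₁ : N → 𝔟` is built from `𝔟 𝔠 = (c)` (every non-zero ideal
  of a Dedekind domain is invertible: `Ideal.dvd_iff_le`) — no projectivity library is used.
* `exists_classMap_nonempty_linearEquiv`: there is a map `cls : {submodules of Rʳ} → Cl(R)ʳ`
  such that two LATTICES with `cls M = cls M'` are isomorphic `R`-modules (by induction on `r`: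
  `cls M = ([pr₁ M], cls (M ∩ 0 × R^{r-1}))`, and ideals in the same class are isomorphic,
  `nonempty_linearEquiv_of_mk0_eq`).  Consequently, when `Cl(R)` is finite (rings of integers of
  number fields), lattices in `Rʳ` fall into finitely many isomorphism classes
  (`exists_infinite_forall_nonempty_linearEquiv`: in any sequence of lattices, infinitely many are
  pairwise isomorphic) — the module-theoretic half of Steinitz's theorem (1911/12) in the form
  used by the Jordan–Zassenhaus finiteness argument, without identifying the complete invariant.
* `exists_end_comp_eq_smul_of_linearEquiv`: an isomorphism `φ : M' ≃ M` of two lattices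
  (`c • Rʳ ⊆ M`, `c' • Rʳ ⊆ M'`) is realised by INTEGRAL endomorphisms `e, e'` of `Rʳ` with
  `e ∘ e' = e' ∘ e = (c c') • id` and `e(M') = c' • M` (`e v = φ (c' v)`, `e' v = φ⁻¹ (c v)`).

These are the global («ideal class») half of the finiteness of isomorphism classes in an
`ℓ`-power isogeny tower of a power of a CM abelian variety (Tate 1966 §2; Shimura 1998 §7.4), cf.
`Literature/NumberTheory/ComplexMultiplication/CMLatticeIdealClassPigeonhole` (rank one).

## References

* [Reiner2003MaximalOrders] I. Reiner, *Maximal Orders* (1975; corrected reprint 2003), §4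
  (modules over Dedekind domains, Steinitz's theorem) and §26 (Jordan–Zassenhaus theorem).
* E. Steinitz, *Rechteckige Systeme und Moduln in algebraischen Zahlkörpern*, Math. Ann. 71
  (1911) 328–354, 72 (1912) 297–345 — the original structure theorem.
-/

noncomputable section

open scoped nonZeroDivisors Pointwise

namespace Literature.Algebra.Module

namespace DedekindLattice

/-! ## §1 Ideals in the same class are isomorphic modules -/

section Ideals

variable {R : Type*} [CommRing R] [IsDomain R]

/-- Multiplication by a non-zero `x` is an `R`-linear isomorphism `I ≃ x • I = (x) I`. [folklore] -/
private theorem nonempty_linearEquiv_span_singleton_mul (I : Ideal R) {x : R} (hx : x ≠ 0) :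
    Nonempty (I ≃ₗ[R] ↥(Ideal.span {x} * I)) := by
  have hinj : Function.Injective (LinearMap.lsmul R R x) := fun a b h => by
    simpa [LinearMap.lsmul_apply, hx] using h
  refine ⟨(Submodule.equivMapOfInjective _ hinj I).trans (LinearEquiv.ofEq _ _ ?_)⟩
  ext a
  simp only [Submodule.mem_map, LinearMap.lsmul_apply, smul_eq_mul, Ideal.mem_span_singleton_mul]

/-- If `(x) I = (y) J` with `x, y ≠ 0` then `I ≅ J` as `R`-modules. [folklore] -/
private theorem nonempty_linearEquiv_of_span_singleton_mul_eq {I J : Ideal R} {x y : R} (hx : x ≠ 0)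
    (hy : y ≠ 0) (h : Ideal.span {x} * I = Ideal.span {y} * J) : Nonempty (I ≃ₗ[R] J) := by
  obtain ⟨e₁⟩ := nonempty_linearEquiv_span_singleton_mul I hx
  obtain ⟨e₂⟩ := nonempty_linearEquiv_span_singleton_mul J hy
  exact ⟨e₁.trans ((LinearEquiv.ofEq _ _ (by rw [h])).trans e₂.symm)⟩

end Ideals

section IdealsDedekind

variable {R : Type*} [CommRing R] [IsDedekindDomain R]

/-- **Ideals of a Dedekind domain with the same ideal class are isomorphic `R`-modules**
(`ClassGroup.mk0_eq_mk0_iff`: `(x) I = (y) J`, and multiplication by `x`, `y`).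
[cite: Reiner2003MaximalOrders, §4 (ideal classes are the isomorphism classes of ideals)] -/
theorem nonempty_linearEquiv_of_mk0_eq {I J : Ideal R} (hI : I ∈ (Ideal R)⁰)
    (hJ : J ∈ (Ideal R)⁰) (h : ClassGroup.mk0 ⟨I, hI⟩ = ClassGroup.mk0 ⟨J, hJ⟩) :
    Nonempty (I ≃ₗ[R] J) := by
  obtain ⟨x, y, hx, hy, hxy⟩ := ClassGroup.mk0_eq_mk0_iff.mp h
  exact nonempty_linearEquiv_of_span_singleton_mul_eq hx hy hxy

end IdealsDedekind

/-! ## §2 The splitting `N ≅ pr₁(N) × (N ∩ 0 × W)` of a lattice over a Dedekind domain -/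

section Splitting

variable {R : Type*} [CommRing R] [IsDedekindDomain R]
  {W : Type*} [AddCommGroup W] [Module R W] [NoZeroSMulDivisors R W]

omit [NoZeroSMulDivisors R W] in
/-- **A lift of `c` with `𝔟`-multiples in `c N`** (the invertibility of `𝔟 = pr₁(N)` made explicit):
if `c • (R × W) ⊆ N`, `c ≠ 0`, there is `w₀ ∈ R × W` with first coordinate `c` such that
`b • w₀ ∈ c • N` for every `b ∈ pr₁(N)`.  Proof: `(c) = 𝔟 𝔠` for an ideal `𝔠` (Dedekind), and for
`a = pr₁(n)`, `d ∈ 𝔠` the element `d • n` has the property, with first coordinate `a d`; these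
generate `𝔟 𝔠 ∋ c`. [folklore] -/
private theorem exists_fst_eq_and_smul_eq_smul (N : Submodule R (R × W)) {c : R}
    (hN : ∀ p : R × W, c • p ∈ N) :
    ∃ w₀ : R × W, w₀.1 = c ∧ ∀ b ∈ N.map (LinearMap.fst R R W), ∃ n ∈ N, b • w₀ = c • n := by
  classical
  set 𝔟 : Ideal R := N.map (LinearMap.fst R R W) with h𝔟
  -- `(c) ≤ 𝔟`, hence `(c) = 𝔟 * 𝔠`
  have hc𝔟 : Ideal.span {c} ≤ 𝔟 := by
    rw [Ideal.span_le, Set.singleton_subset_iff]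
    exact ⟨c • ((1 : R), (0 : W)), hN _, by simp⟩
  obtain ⟨𝔠, h𝔠⟩ := Ideal.dvd_iff_le.mpr hc𝔟
  -- the submodule of elements with the property
  let Q : Submodule R (R × W) :=
    { carrier := {p | ∀ b ∈ 𝔟, ∃ n ∈ N, b • p = c • n}
      add_mem' := fun {p q} hp hq b hb => by
        obtain ⟨n, hn, hnp⟩ := hp b hb
        obtain ⟨n', hn', hnq⟩ := hq b hb
        exact ⟨n + n', N.add_mem hn hn', by rw [smul_add, hnp, hnq, smul_add]⟩
      zero_mem' := fun b _ => ⟨0, N.zero_mem, by simp⟩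
      smul_mem' := fun a p hp b hb => by
        obtain ⟨n, hn, hnp⟩ := hp b hb
        exact ⟨a • n, N.smul_mem a hn, by rw [smul_comm, hnp, smul_comm]⟩ }
  have hQ : ∀ p, p ∈ Q ↔ ∀ b ∈ 𝔟, ∃ n ∈ N, b • p = c • n := fun p => Iff.rfl
  -- `𝔟 * 𝔠 ≤ pr₁(Q)`
  have hle : 𝔟 * 𝔠 ≤ Q.map (LinearMap.fst R R W) := by
    refine Ideal.mul_le.mpr fun a ha d hd => ?_
    obtain ⟨n, hn, rfl⟩ := (Submodule.mem_map.mp ha)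
    refine Submodule.mem_map.mpr ⟨d • n, ?_, by simp [mul_comm]⟩
    rw [hQ]
    intro b hb
    have hbd : b * d ∈ Ideal.span {c} := h𝔠 ▸ Ideal.mul_mem_mul hb hd
    obtain ⟨u, hu⟩ := Ideal.mem_span_singleton'.mp hbd
    exact ⟨u • n, N.smul_mem u hn, by rw [← mul_smul, ← hu, mul_comm u c, mul_smul]⟩
  have hcQ : c ∈ Q.map (LinearMap.fst R R W) :=
    hle (h𝔠 ▸ Ideal.mem_span_singleton_self c)
  obtain ⟨w₀, hw₀, hw₀c⟩ := Submodule.mem_map.mp hcQ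
  exact ⟨w₀, hw₀c, (hQ w₀).mp hw₀⟩

/-- **Splitting of a lattice over a Dedekind domain**: if `c • (R × W) ⊆ N` with `c ≠ 0`
(`W` torsion-free), then `N ≅ pr₁(N) × (N ∩ ({0} × W))` as `R`-modules — the section
`s : pr₁(N) → N` being `s(b) = ` the unique `n` with `c • n = b • w₀`
(`exists_fst_eq_and_smul_eq_smul`).  This is the inductive step of Steinitz's theorem.
[cite: Reiner2003MaximalOrders, §4 (Steinitz's theorem, inductive step)] -/
theorem nonempty_linearEquiv_prod_of_smul_mem (N : Submodule R (R × W)) {c : R} (hc : c ≠ 0)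
    (hN : ∀ p : R × W, c • p ∈ N) :
    Nonempty (N ≃ₗ[R] (↥(N.map (LinearMap.fst R R W)) × ↥(N.comap (LinearMap.inr R R W)))) := by
  classical
  obtain ⟨w₀, hw₀c, hw₀⟩ := exists_fst_eq_and_smul_eq_smul N hN
  set 𝔟 : Ideal R := N.map (LinearMap.fst R R W) with h𝔟
  set N₁ : Submodule R W := N.comap (LinearMap.inr R R W) with hN₁
  -- torsion-freeness of `R × W`
  have hinj : ∀ {p q : R × W}, c • p = c • q → p = q := fun {p q} h => by
    have h1 : c * p.1 = c * q.1 := by simpa using congrArg Prod.fst h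
    have h2 : c • p.2 = c • q.2 := by simpa using congrArg Prod.snd h
    exact Prod.ext (mul_left_cancel₀ hc h1) (smul_right_injective W hc h2)
  -- the section
  have hsec : ∀ b : 𝔟, ∃ n : N, c • (n : R × W) = (b : R) • w₀ := fun b => by
    obtain ⟨n, hn, h⟩ := hw₀ b b.2
    exact ⟨⟨n, hn⟩, h.symm⟩
  choose sf hsf using hsec
  have sf_add : ∀ b b' : 𝔟, sf (b + b') = sf b + sf b' := fun b b' => by
    apply Subtype.ext
    apply hinj
    rw [hsf, Submodule.coe_add, Submodule.coe_add, smul_add, hsf, hsf, add_smul]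
  have sf_smul : ∀ (a : R) (b : 𝔟), sf (a • b) = a • sf b := fun a b => by
    apply Subtype.ext
    apply hinj
    rw [hsf, Submodule.coe_smul, Submodule.coe_smul, smul_comm, hsf, smul_eq_mul, mul_smul]
  let s : 𝔟 →ₗ[R] N := { toFun := sf, map_add' := sf_add, map_smul' := sf_smul }
  have hs : ∀ b : 𝔟, c • ((s b : N) : R × W) = (b : R) • w₀ := hsf
  -- `pr₁ (s b) = b`
  have hs1 : ∀ b : 𝔟, ((s b : N) : R × W).1 = b := fun b => by
    have := congrArg Prod.fst (hs b)
    simp only [Prod.smul_fst, smul_eq_mul, hw₀c] at this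
    exact mul_left_cancel₀ hc (by rw [this, mul_comm])
  -- the first projection `N → 𝔟`
  let π : N →ₗ[R] 𝔟 :=
    ((LinearMap.fst R R W).comp N.subtype).codRestrict 𝔟 fun n =>
      Submodule.mem_map_of_mem n.2
  have hπ : ∀ n : N, ((π n : 𝔟) : R) = (n : R × W).1 := fun n => rfl
  -- the kernel part `n - s (π n)` lies in `0 × W`
  have hker : ∀ n : N, ((n - s (π n) : N) : R × W) =
      LinearMap.inr R R W ((n - s (π n) : N) : R × W).2 := fun n => by
    refine Prod.ext ?_ rfl
    simp only [Submodule.coe_sub, Prod.fst_sub, LinearMap.inr_apply, hs1, hπ, sub_self]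
  have hker' : ∀ n : N, ((n - s (π n) : N) : R × W).2 ∈ N₁ := fun n => by
    change LinearMap.inr R R W _ ∈ N
    rw [← hker]
    exact (n - s (π n)).2
  let κ : N →ₗ[R] N₁ :=
    { toFun := fun n => ⟨((n - s (π n) : N) : R × W).2, hker' n⟩
      map_add' := fun n n' => by
        apply Subtype.ext
        simp only [map_add, Submodule.coe_add, Submodule.coe_sub, Prod.snd_add, Prod.snd_sub]
        abel
      map_smul' := fun a n => by
        apply Subtype.ext
        simp only [map_smul, Submodule.coe_smul, Submodule.coe_sub, Prod.smul_snd, Prod.snd_sub,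
          RingHom.id_apply, smul_sub] }
  have hκ : ∀ n : N, ((κ n : N₁) : W) = ((n - s (π n) : N) : R × W).2 := fun n => rfl
  let f : N →ₗ[R] 𝔟 × N₁ := π.prod κ
  let ι₁ : N₁ →ₗ[R] N := (LinearMap.inr R R W).restrict fun u hu => hu
  have hι₁ : ∀ u : N₁, ((ι₁ u : N) : R × W) = LinearMap.inr R R W u := fun u => rfl
  let g : 𝔟 × N₁ →ₗ[R] N := s.coprod ι₁
  refine ⟨LinearEquiv.ofLinear f g ?_ ?_⟩
  · -- `f ∘ g = id`
    apply LinearMap.ext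
    rintro ⟨b, u⟩
    have hgu : (g (b, u) : R × W) = ((s b : N) : R × W) + LinearMap.inr R R W u := by
      simp only [g, LinearMap.coprod_apply, Submodule.coe_add, hι₁]
    have hπg : π (g (b, u)) = b := by
      apply Subtype.ext
      rw [hπ, hgu, Prod.fst_add, hs1, LinearMap.inr_apply, add_zero]
    refine Prod.ext hπg ?_
    apply Subtype.ext
    change ((κ (g (b, u)) : N₁) : W) = u
    rw [hκ, Submodule.coe_sub, hπg, hgu, add_sub_cancel_left, LinearMap.inr_apply]
  · -- `g ∘ f = id`
    apply LinearMap.ext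
    intro n
    apply Subtype.ext
    change ((s (π n) : N) : R × W) + LinearMap.inr R R W ((κ n : N₁) : W) = n
    rw [hκ, ← hker, Submodule.coe_sub, add_sub_cancel]

end Splitting

/-! ## §3 The class map on lattices in `Rʳ` -/

section ClassMap

variable {R : Type*} [CommRing R] [IsDedekindDomain R]

/-- The ideal class of an ideal, `1` for the zero ideal (total version of `ClassGroup.mk0`). [folklore] -/
private theorem exists_idealClass :
    ∃ icl : Ideal R → ClassGroup R, ∀ (I : Ideal R) (hI : I ∈ (Ideal R)⁰), icl I = ClassGroup.mk0 ⟨I, hI⟩ := by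
  classical
  refine ⟨fun I => if hI : I ∈ (Ideal R)⁰ then ClassGroup.mk0 ⟨I, hI⟩ else 1, fun I hI => ?_⟩
  simp only [hI, dif_pos]

/-- **Lattices in `Rʳ` with equal class data are isomorphic** (Steinitz's induction): there is a
map `cls` from submodules of `Rʳ = Fin r → R` to `Cl(R)ʳ` such that any two LATTICES `M, M'`
(`c • Rʳ ⊆ M`, `c' • Rʳ ⊆ M'` with `c, c' ≠ 0`) with `cls M = cls M'` are isomorphic
`R`-modules.  (`cls M = ([pr₁ M], cls (M ∩ 0 × R^{r-1}))` recursively; the complete invariant —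
the Steinitz class — is not needed here.) [cite: Reiner2003MaximalOrders, §4 (Steinitz's theorem)] -/
theorem exists_classMap_nonempty_linearEquiv (r : ℕ) :
    ∃ cls : Submodule R (Fin r → R) → (Fin r → ClassGroup R),
      ∀ M M' : Submodule R (Fin r → R),
        (∃ c : R, c ≠ 0 ∧ ∀ v, c • v ∈ M) → (∃ c : R, c ≠ 0 ∧ ∀ v, c • v ∈ M') →
        cls M = cls M' → Nonempty (M ≃ₗ[R] M') := by
  classical
  obtain ⟨icl, hicl⟩ := exists_idealClass (R := R)
  induction r with
  | zero =>
    refine ⟨fun _ => Fin.elim0, fun M M' _ _ _ => ⟨LinearEquiv.ofEq M M' ?_⟩⟩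
    ext v
    rw [Subsingleton.elim v 0]
    exact ⟨fun _ => M'.zero_mem, fun _ => M.zero_mem⟩
  | succ r ih =>
    obtain ⟨cls, hcls⟩ := ih
    -- `R^{r+1} ≅ R × Rʳ`
    let E : (R × (Fin r → R)) ≃ₗ[R] (Fin (r + 1) → R) := Fin.consLinearEquiv R fun _ : Fin (r + 1) => R
    let fl : Submodule R (Fin (r + 1) → R) → Submodule R (R × (Fin r → R)) := fun M =>
      M.map (E.symm : (Fin (r + 1) → R) →ₗ[R] R × (Fin r → R))
    let hd : Submodule R (Fin (r + 1) → R) → Ideal R := fun M =>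
      (fl M).map (LinearMap.fst R R (Fin r → R))
    let tl : Submodule R (Fin (r + 1) → R) → Submodule R (Fin r → R) := fun M =>
      (fl M).comap (LinearMap.inr R R (Fin r → R))
    refine ⟨fun M => Fin.cons (icl (hd M)) (cls (tl M)), fun M M' hM hM' hMM' => ?_⟩
    -- unpack the equal class data
    have hhd : icl (hd M) = icl (hd M') := by simpa using congrFun hMM' 0
    have htl : cls (tl M) = cls (tl M') := by
      funext i; simpa using congrFun hMM' i.succ
    -- lattice properties transfer
    have hfl : ∀ {M : Submodule R (Fin (r + 1) → R)} {c : R}, (∀ v, c • v ∈ M) →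
        ∀ p, c • p ∈ fl M := fun {M c} h p =>
      Submodule.mem_map.mpr ⟨c • E p, h _, by simp⟩
    have htl' : ∀ {M : Submodule R (Fin (r + 1) → R)} {c : R}, (∀ v, c • v ∈ M) →
        ∀ u, c • u ∈ tl M := fun {M c} h u => by
      change LinearMap.inr R R (Fin r → R) (c • u) ∈ fl M
      rw [map_smul]; exact hfl h _
    have hhd' : ∀ {M : Submodule R (Fin (r + 1) → R)} {c : R}, c ≠ 0 → (∀ v, c • v ∈ M) →
        hd M ∈ (Ideal R)⁰ := fun {M c} hc h => by
      refine mem_nonZeroDivisors_iff_ne_zero.mpr fun h0 => hc ?_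
      have : c ∈ hd M := Submodule.mem_map.mpr ⟨c • ((1 : R), (0 : Fin r → R)), hfl h _, by simp⟩
      rw [h0] at this
      exact (Submodule.mem_bot R).mp this
    obtain ⟨c, hc, hcM⟩ := hM
    obtain ⟨c', hc', hcM'⟩ := hM'
    -- the three isomorphisms
    obtain ⟨e₁⟩ := nonempty_linearEquiv_prod_of_smul_mem (fl M) hc (hfl hcM)
    obtain ⟨e₁'⟩ := nonempty_linearEquiv_prod_of_smul_mem (fl M') hc' (hfl hcM')
    have hcl : ClassGroup.mk0 ⟨hd M, hhd' hc hcM⟩ = ClassGroup.mk0 ⟨hd M', hhd' hc' hcM'⟩ := by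
      rw [← hicl, ← hicl]; exact hhd
    obtain ⟨e₂⟩ := nonempty_linearEquiv_of_mk0_eq _ _ hcl
    obtain ⟨e₃⟩ := hcls (tl M) (tl M') ⟨c, hc, htl' hcM⟩ ⟨c', hc', htl' hcM'⟩ htl
    have e₀ : M ≃ₗ[R] ↥(fl M) := E.symm.submoduleMap M
    have e₀' : M' ≃ₗ[R] ↥(fl M') := E.symm.submoduleMap M'
    exact ⟨e₀.trans (e₁.trans ((e₂.prodCongr e₃).trans (e₁'.symm.trans e₀'.symm)))⟩

/-- **Finitely many isomorphism classes of lattices in `Rʳ` when `Cl(R)` is finite** (e.g. `R`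
the ring of integers of a number field), in sequence form: among any sequence of lattices
`M i ⊆ Rʳ` (`c_i • Rʳ ⊆ M i`, `c_i ≠ 0`) infinitely many are pairwise isomorphic `R`-modules
(pigeonhole on `exists_classMap_nonempty_linearEquiv`). Jordan–Zassenhaus for the maximal order.
[cite: Reiner2003MaximalOrders, §26 (Jordan–Zassenhaus theorem)] -/
theorem exists_infinite_forall_nonempty_linearEquiv [Finite (ClassGroup R)] (r : ℕ)
    (M : ℕ → Submodule R (Fin r → R)) (hM : ∀ i, ∃ c : R, c ≠ 0 ∧ ∀ v, c • v ∈ M i) :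
    ∃ S : Set ℕ, S.Infinite ∧ ∀ m ∈ S, ∀ n ∈ S, Nonempty (M m ≃ₗ[R] M n) := by
  classical
  obtain ⟨cls, hcls⟩ := exists_classMap_nonempty_linearEquiv (R := R) r
  obtain ⟨y, hy⟩ := Finite.exists_infinite_fiber fun i : ℕ => cls (M i)
  refine ⟨(fun i : ℕ => cls (M i)) ⁻¹' {y}, Set.infinite_coe_iff.mp hy, fun m hm n hn => ?_⟩
  exact hcls _ _ (hM m) (hM n) (by rw [show cls (M m) = y from hm, show cls (M n) = y from hn])

end ClassMap

/-! ## §4 From an isomorphism of lattices to integral endomorphisms of `Rʳ` -/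

section Integral

variable {R : Type*} [CommRing R] {V : Type*} [AddCommGroup V] [Module R V]

/-- **An isomorphism of lattices is realised by integral endomorphisms up to scalars**: if
`φ : M' ≃ M` with `c • V ⊆ M` and `c' • V ⊆ M'`, then `e v = φ (c' v)` and `e' v = φ⁻¹ (c v)` are
endomorphisms of `V` with `e ∘ e' = e' ∘ e = (c c') • id` and `e(M') = c' • M`.  (For
`V = Rʳ` these are the integral matrices transporting one lattice to the other — the endomorphisms
`u` with `u T_m = T_n` of Tate's finiteness argument.) [cite: Tate1966Endomorphisms, §2 pp. 136–137] -/
theorem exists_end_comp_eq_smul_of_linearEquiv {M M' : Submodule R V} (φ : M' ≃ₗ[R] M) {c c' : R}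
    (hc : ∀ v, c • v ∈ M) (hc' : ∀ v, c' • v ∈ M') :
    ∃ e e' : V →ₗ[R] V, e.comp e' = (c * c') • LinearMap.id ∧ e'.comp e = (c * c') • LinearMap.id ∧
      (∀ v, e v = (φ ⟨c' • v, hc' v⟩ : V)) ∧ (∀ v, e' v = (φ.symm ⟨c • v, hc v⟩ : V)) ∧
      M'.map e = c' • M := by
  let ic' : V →ₗ[R] M' :=
    { toFun := fun v => ⟨c' • v, hc' v⟩
      map_add' := fun v w => Subtype.ext (smul_add _ _ _)
      map_smul' := fun a v => Subtype.ext (smul_comm _ _ _) }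
  let ic : V →ₗ[R] M :=
    { toFun := fun v => ⟨c • v, hc v⟩
      map_add' := fun v w => Subtype.ext (smul_add _ _ _)
      map_smul' := fun a v => Subtype.ext (smul_comm _ _ _) }
  let e : V →ₗ[R] V := M.subtype.comp ((φ : M' →ₗ[R] M).comp ic')
  let e' : V →ₗ[R] V := M'.subtype.comp ((φ.symm : M →ₗ[R] M').comp ic)
  have he : ∀ v, e v = (φ ⟨c' • v, hc' v⟩ : V) := fun v => rfl
  have he' : ∀ v, e' v = (φ.symm ⟨c • v, hc v⟩ : V) := fun v => rfl
  refine ⟨e, e', ?_, ?_, he, he', ?_⟩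
  · apply LinearMap.ext
    intro v
    rw [LinearMap.comp_apply, he, LinearMap.smul_apply, LinearMap.id_apply]
    have h1 : (⟨c' • e' v, hc' (e' v)⟩ : M') = c' • φ.symm ⟨c • v, hc v⟩ :=
      Subtype.ext (by rw [Submodule.coe_smul, he'])
    rw [h1, map_smul, LinearEquiv.apply_symm_apply, Submodule.coe_smul, mul_comm, mul_smul]
  · apply LinearMap.ext
    intro v
    rw [LinearMap.comp_apply, he', LinearMap.smul_apply, LinearMap.id_apply]
    have h1 : (⟨c • e v, hc (e v)⟩ : M) = c • φ ⟨c' • v, hc' v⟩ :=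
      Subtype.ext (by rw [Submodule.coe_smul, he])
    rw [h1, map_smul, LinearEquiv.symm_apply_apply, Submodule.coe_smul, mul_smul]
  · apply le_antisymm
    · rintro _ ⟨v, hv, rfl⟩
      rw [he]
      have h1 : (⟨c' • v, hc' v⟩ : M') = c' • (⟨v, hv⟩ : M') := Subtype.ext rfl
      rw [h1, map_smul, Submodule.coe_smul]
      exact Submodule.smul_mem_pointwise_smul _ _ _ (φ ⟨v, hv⟩).2
    · intro w hw
      obtain ⟨m, hm, rfl⟩ := (Submodule.mem_smul_pointwise_iff_exists _ _ _).mp hw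
      refine ⟨(φ.symm ⟨m, hm⟩ : V), (φ.symm ⟨m, hm⟩).2, ?_⟩
      rw [he]
      have h1 : (⟨c' • (φ.symm ⟨m, hm⟩ : V), hc' _⟩ : M') = c' • φ.symm ⟨m, hm⟩ := Subtype.ext rfl
      rw [h1, map_smul, LinearEquiv.apply_symm_apply, Submodule.coe_smul]

end Integral

end DedekindLattice

end Literature.Algebra.Module

end
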